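import Summits.MatrixMultiplication.MatrixMultiplication.Theses.LevelGradedCohnUmans
import Summits.MatrixMultiplication.MatrixMultiplication.Theorems.LieRankDesigns.Negative.Basics

/-!
# Negative lemmas for the crux `LevelOneGL2Designs` (stmt-MatrixMultiplication-14080), part A

Refuter-side (cdisprove) load-bearing analysis of `LevelGradedCohnUmans.LevelOneGL2Designs`
(`∃ c > 0`, for unboundedly many primes `p`, rank-1-separated `X, Y, Z ⊆ GL_2(𝔽_p)` with all three
sets `≥ c·p^{3/2}`); no theorem here asserts a Theses statement positively.  Vocabulary (`GLm`,
`Mat`, `fourierFn`, `RankSupp`, `RankSep`) is the sibling crux's landed `LieRankDesigns.Negative.Basics`.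

* `levelOneGL2Designs_iff_rankSep` — the crux in that vocabulary, by `Iff.rfl`.
* `card_le_card_rankLE_of_deltas`, `wall_XZ` — the interpolation bound and the wall
  `|X|·|Z| ≤ N_k := #{M : rk M ≤ k}` (the `XZ` case needs no translation), after the sibling seat's
  work file `Cruxes/LieRankDesigns/Disproof.lean` (not importable from `Theorems/`).
* `rank_le_one_iff_det_eq_zero`, `card_GL2`, `card_mat2`, `card_rankLE_two_one` — the EXACT level-one
  support count `N₁(p) = #{M ∈ M_2(𝔽_p) : rk M ≤ 1} = p³ + p² − p` (`= p⁴ − |GL_2(𝔽_p)|`).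
* `wall_XZ_levelOne` — `|X|·|Z| ≤ p³ + p² − p` for every level-one witness.
* `not_levelOneGL2Designs_exp` — STRENGTHENING REFUTED: the crux with `p^{3/2}` replaced by `p^e`,
  `e > 3/2`, is false; the exponent `3/2` is tight (it is the wall exponent `W^{1/2}`, `W ≈ p³`).
-/

noncomputable section

open scoped BigOperators

namespace Summit.MatrixMultiplication.MatrixMultiplication.Theorems.LevelOneGL2Designs.Negative

open Summit.MatrixMultiplication.MatrixMultiplication.Theses.LevelGradedCohnUmans
open Summit.MatrixMultiplication.MatrixMultiplication.Theorems.LieRankDesigns.Negative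

variable {p m : ℕ}

/-- The crux in the vocabulary of `LieRankDesigns.Negative.Basics` (`GLm p 2`, `RankSep 1`), by
`Iff.rfl` — so every lemma below is about the statement as filed. -/
theorem levelOneGL2Designs_iff_rankSep :
    LevelOneGL2Designs ↔
      ∃ c : ℝ, 0 < c ∧ ∀ p₀ : ℕ, ∃ (p : ℕ) (_ : Fact p.Prime), p₀ ≤ p ∧
        ∃ X Y Z : Finset (GLm p 2), RankSep 1 X Y Z ∧
          c * (p : ℝ) ^ (3 / 2 : ℝ) ≤ X.card ∧ c * (p : ℝ) ^ (3 / 2 : ℝ) ≤ Y.card ∧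
          c * (p : ℝ) ^ (3 / 2 : ℝ) ≤ Z.card :=
  Iff.rfl

/-! ## The interpolation bound and the wall `|X|·|Z| ≤ N_k` -/

section Wall

variable [Fact p.Prime]

/-- Sum over all matrices of a rank-supported table = sum over the rank-`≤ k` ones. [folklore] -/
theorem sum_eq_sum_rankLE {k : ℕ} {c : Mat p m → ℂ} (hc : RankSupp k c) (w : Mat p m → ℂ) :
    ∑ M : Mat p m, c M * w M = ∑ M : {M : Mat p m // M.rank ≤ k}, c M.1 * w M.1 := by
  classical
  rw [← Finset.sum_filter_of_ne (p := fun M : Mat p m => M.rank ≤ k)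
      (fun M _ hM => le_of_not_gt fun hlt => hM (by rw [hc M hlt, zero_mul]))]
  exact Finset.sum_subtype _ (by simp) _

/-- The read-out map `c ↦ (t ↦ Σ_{rk M ≤ k} c_M ψ(tr(M π(t))))`, linear in the coefficient table. -/
def readout {k : ℕ} {T : Type} (π : T → GLm p m) :
    ({M : Mat p m // M.rank ≤ k} → ℂ) →ₗ[ℂ] (T → ℂ) where
  toFun c t := ∑ M : {M : Mat p m // M.rank ≤ k},
    c M * ZMod.stdAddChar (Matrix.trace (M.1 * (π t : Mat p m)))
  map_add' c c' := by
    funext t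
    simp only [Pi.add_apply, add_mul, Finset.sum_add_distrib]
  map_smul' r c := by
    funext t
    simp only [Pi.smul_apply, smul_eq_mul, RingHom.id_apply, Finset.mul_sum, mul_assoc]

/-- The read-out of a restricted rank-supported table is the Fourier function. [folklore] -/
theorem readout_restrict {k : ℕ} {T : Type} (π : T → GLm p m) {c : Mat p m → ℂ}
    (hc : RankSupp k c) (t : T) :
    readout π (fun M : {M : Mat p m // M.rank ≤ k} => c M.1) t = fourierFn c (π t) := by
  unfold fourierFn
  rw [sum_eq_sum_rankLE hc]
  rfl

/-- **Interpolation bound** (after the sibling seat): if level-`k` Fourier functions realise every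
delta function on a finite configuration `π : T → GL_m(𝔽_p)`, then `|T| ≤ N_k = #{M : rk M ≤ k}`
(the read-out map from the `N_k`-dimensional coefficient space onto `ℂ^T` is surjective). -/
theorem card_le_card_rankLE_of_deltas {k : ℕ} {T : Type} [Fintype T] [DecidableEq T]
    (π : T → GLm p m)
    (hδ : ∀ t : T, ∃ c : Mat p m → ℂ, RankSupp k c ∧
      ∀ t' : T, fourierFn c (π t') = if t' = t then 1 else 0) :
    Fintype.card T ≤ Fintype.card {M : Mat p m // M.rank ≤ k} := by
  classical
  have hsurj : Function.Surjective (readout (k := k) π) := by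
    rw [← LinearMap.range_eq_top, eq_top_iff, ← (Pi.basisFun ℂ T).span_eq, Submodule.span_le]
    rintro _ ⟨t, rfl⟩
    obtain ⟨c, hc, hct⟩ := hδ t
    refine ⟨fun M => c M.1, ?_⟩
    funext t'
    rw [readout_restrict π hc, hct, Pi.basisFun_apply, Pi.single_apply]
  have h := LinearMap.finrank_le_finrank_of_surjective hsurj
  rwa [Module.finrank_fintype_fun_eq_card, Module.finrank_fintype_fun_eq_card] at h

/-- **Wall XZ** (after the sibling seat): an `F_k`-separated triple with `Y ≠ ∅` has
`|X|·|Z| ≤ N_k` — the separating functions themselves realise the deltas on `X⁻¹Z` (put `y = y'`). -/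
theorem wall_XZ {k : ℕ} {X Y Z : Finset (GLm p m)} (hsep : RankSep k X Y Z) (hY : Y.Nonempty) :
    X.card * Z.card ≤ Fintype.card {M : Mat p m // M.rank ≤ k} := by
  classical
  obtain ⟨y₀, hy₀⟩ := hY
  have h := card_le_card_rankLE_of_deltas (k := k) (T := ↥(X ×ˢ Z))
    (fun t => t.1.1⁻¹ * t.1.2) ?_
  · rwa [Fintype.card_coe, Finset.card_product] at h
  rintro ⟨⟨x₀, z₀⟩, ht⟩
  rw [Finset.mem_product] at ht
  obtain ⟨c, hc, hsepc⟩ := hsep x₀ ht.1 z₀ ht.2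
  refine ⟨c, hc, ?_⟩
  rintro ⟨⟨x, z⟩, ht'⟩
  rw [Finset.mem_product] at ht'
  rw [show x⁻¹ * z = x⁻¹ * y₀ * y₀⁻¹ * z by group, hsepc x ht'.1 y₀ hy₀ y₀ hy₀ z ht'.2]
  congr 1
  simp only [true_and, Subtype.mk.injEq, Prod.mk.injEq]

end Wall

/-! ## The exact level-one support count `N₁(p) = p³ + p² − p` -/

section Count

variable [Fact p.Prime]

/-- For a `2 × 2` matrix over `𝔽_p`: Fourier rank `≤ 1` iff singular. [folklore] -/
theorem rank_le_one_iff_det_eq_zero (M : Mat p 2) : M.rank ≤ 1 ↔ M.det = 0 := by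
  constructor
  · intro h
    by_contra hdet
    have hU : IsUnit M :=
      (Matrix.isUnit_iff_isUnit_det M).mpr (isUnit_iff_ne_zero.mpr hdet)
    have h2 := Matrix.rank_of_isUnit M hU
    rw [Fintype.card_fin] at h2
    omega
  · intro hdet
    have hlt : M.rank < 2 := by
      refine lt_of_le_of_ne (by simpa using Matrix.rank_le_card_width M) fun hr => ?_
      have hsurj : Function.Surjective M.mulVec := by
        have htop : LinearMap.range M.mulVecLin = ⊤ := by
          apply Submodule.eq_top_of_finrank_eq
          rw [Module.finrank_fintype_fun_eq_card, Fintype.card_fin]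
          exact hr
        intro v
        have hv : v ∈ LinearMap.range M.mulVecLin := htop ▸ Submodule.mem_top
        obtain ⟨w, hw⟩ := hv
        exact ⟨w, hw⟩
      have hunit : IsUnit M := Matrix.mulVec_surjective_iff_isUnit.1 hsurj
      exact ((Matrix.isUnit_iff_isUnit_det M).1 hunit).ne_zero hdet
    omega

/-- `|GL_2(𝔽_p)| = (p² − 1)(p² − p)` (Mathlib's `Matrix.card_GL_field`). [folklore] -/
theorem card_GL2 : Fintype.card (GLm p 2) = (p ^ 2 - 1) * (p ^ 2 - p) := by
  rw [Fintype.card_eq_nat_card, Matrix.card_GL_field]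
  simp [Fin.prod_univ_two, ZMod.card]

/-- The invertible matrices, as the subtype `det ≠ 0` of all matrices. -/
def glEquivDetNeZero : GLm p 2 ≃ {M : Mat p 2 // ¬ M.det = 0} where
  toFun g := ⟨(g : Mat p 2), ((Matrix.isUnit_iff_isUnit_det _).mp (Units.isUnit g)).ne_zero⟩
  invFun M := Matrix.GeneralLinearGroup.mkOfDetNeZero M.1 M.2
  left_inv _ := Units.ext rfl
  right_inv _ := Subtype.ext rfl

/-- `#M_2(𝔽_p) = p⁴`. [folklore] -/
theorem card_mat2 : Fintype.card (Mat p 2) = p ^ 4 := by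
  simp [Matrix, Fintype.card_fin, ZMod.card]
  ring

/-- **Exact size of the level-one Fourier support**: `N₁(p) = #{M ∈ M_2(𝔽_p) : rk M ≤ 1} =
p³ + p² − p` (the singular matrices, `p⁴ − |GL_2(𝔽_p)|`).  The true dimension
`dim F_1|_G = p³ + p² − 3p − 1` is smaller by `2p + 1` (the relations `Σ_{col M = ℓ} ψ(tr(M·)) = −1`
and their row analogues), which is asymptotically immaterial. [folklore] -/
theorem card_rankLE_two_one :
    Fintype.card {M : Mat p 2 // M.rank ≤ 1} = p ^ 3 + p ^ 2 - p := by
  classical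
  have h1 : Fintype.card {M : Mat p 2 // M.rank ≤ 1} = Fintype.card {M : Mat p 2 // M.det = 0} :=
    Fintype.card_congr (Equiv.subtypeEquivRight fun M => rank_le_one_iff_det_eq_zero M)
  have h2 : Fintype.card {M : Mat p 2 // ¬ M.det = 0} = (p ^ 2 - 1) * (p ^ 2 - p) := by
    rw [← card_GL2]; exact (Fintype.card_congr glEquivDetNeZero).symm
  have h3 : Fintype.card {M : Mat p 2 // M.det = 0} + Fintype.card {M : Mat p 2 // ¬ M.det = 0}
      = p ^ 4 := by
    rw [Fintype.card_subtype_compl, ← card_mat2]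
    exact Nat.add_sub_of_le (Fintype.card_subtype_le _)
  rw [h1]
  rw [h2] at h3
  have hp : 1 ≤ p := (Fact.out : p.Prime).one_lt.le
  have hp2 : p ≤ p ^ 2 := by nlinarith
  have hp1 : 1 ≤ p ^ 2 := le_trans hp hp2
  zify [hp1, hp2, show p ≤ p ^ 3 + p ^ 2 by nlinarith] at h3 ⊢
  linear_combination h3

/-- **Wall XZ at level one**: `|X|·|Z| ≤ p³ + p² − p` for every rank-1-separated triple of
`GL_2(𝔽_p)` with `Y ≠ ∅`. -/
theorem wall_XZ_levelOne {X Y Z : Finset (GLm p 2)} (hsep : RankSep 1 X Y Z) (hY : Y.Nonempty) :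
    X.card * Z.card ≤ p ^ 3 + p ^ 2 - p := by
  rw [← card_rankLE_two_one]; exact wall_XZ hsep hY

/-- The wall in real form: `|X|·|Z| ≤ p³ + p²`. -/
theorem wall_XZ_real {X Y Z : Finset (GLm p 2)} (hsep : RankSep 1 X Y Z) (hY : Y.Nonempty) :
    ((X.card * Z.card : ℕ) : ℝ) ≤ (p : ℝ) ^ 3 + (p : ℝ) ^ 2 := by
  have h := (wall_XZ_levelOne hsep hY).trans (Nat.sub_le _ _)
  exact_mod_cast h

end Count

/-! ## Real-exponent bookkeeping -/

section Rpow

variable [Fact p.Prime]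

/-- `0 < p` in `ℝ`. -/
theorem prime_cast_pos : (0 : ℝ) < p := by exact_mod_cast (Fact.out : p.Prime).pos

/-- `1 ≤ p` in `ℝ`. -/
theorem one_le_prime_cast : (1 : ℝ) ≤ p := by exact_mod_cast (Fact.out : p.Prime).one_lt.le

/-- `p^{3/2} · p^{3/2} = p³`. -/
theorem rpow_three_halves_mul_self :
    (p : ℝ) ^ (3 / 2 : ℝ) * (p : ℝ) ^ (3 / 2 : ℝ) = (p : ℝ) ^ 3 := by
  rw [← Real.rpow_add prime_cast_pos, show (3 / 2 : ℝ) + 3 / 2 = ((3 : ℕ) : ℝ) by norm_num,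
    Real.rpow_natCast]

/-- `p ≤ p^{3/2}`. -/
theorem prime_cast_le_rpow_three_halves : (p : ℝ) ≤ (p : ℝ) ^ (3 / 2 : ℝ) := by
  conv_lhs => rw [← Real.rpow_one (p : ℝ)]
  exact Real.rpow_le_rpow_of_exponent_le one_le_prime_cast (by norm_num)

/-- `p^{3/2} ≤ p²`. -/
theorem rpow_three_halves_le_sq : (p : ℝ) ^ (3 / 2 : ℝ) ≤ (p : ℝ) ^ 2 := by
  have h := Real.rpow_le_rpow_of_exponent_le (one_le_prime_cast (p := p))
    (show (3 / 2 : ℝ) ≤ (2 : ℕ) by norm_num)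
  rwa [Real.rpow_natCast] at h

omit [Fact p.Prime] in
/-- Lower bounds on two sets multiply: `(c p^e)² ≤ |A|·|B|` (as reals). -/
theorem sq_le_card_mul {c e : ℝ} (hc : 0 ≤ c) {a b : ℕ} (ha : c * (p : ℝ) ^ e ≤ a)
    (hb : c * (p : ℝ) ^ e ≤ b) : (c * (p : ℝ) ^ e) * (c * (p : ℝ) ^ e) ≤ ((a * b : ℕ) : ℝ) := by
  push_cast
  exact mul_le_mul ha hb (by positivity) (le_trans (by positivity) ha)

end Rpow

/-! ## STRENGTHENING REFUTED: the exponent `3/2` cannot be raised -/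

/-- **The exponent is tight.**  For every `e > 3/2` the `p^e`-version of `LevelOneGL2Designs` is
FALSE: the wall gives `c²p^{2e} ≤ |X||Z| ≤ N₁(p) ≤ p³ + p² < 2p³`, impossible once
`p^{2e−3} ≥ 2/c²`.  (Only the `X`- and `Z`-bounds and `Y ≠ ∅` are used; `e = 3/2` is the crux by
`levelOneGL2Designs_iff_rankSep`.) -/
theorem not_levelOneGL2Designs_exp {e : ℝ} (he : 3 / 2 < e) :
    ¬ ∃ c : ℝ, 0 < c ∧ ∀ p₀ : ℕ, ∃ (p : ℕ) (_ : Fact p.Prime), p₀ ≤ p ∧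
        ∃ X Y Z : Finset (GLm p 2), RankSep 1 X Y Z ∧
          c * (p : ℝ) ^ e ≤ X.card ∧ c * (p : ℝ) ^ e ≤ Y.card ∧ c * (p : ℝ) ^ e ≤ Z.card := by
  rintro ⟨c, hc, hall⟩
  have hδ : 0 < 2 * e - 3 := by linarith
  set K : ℝ := (2 / c ^ 2) ^ (1 / (2 * e - 3)) with hK
  obtain ⟨N, hN⟩ := exists_nat_gt (max 2 K)
  obtain ⟨p, hprime, hNp, X, Y, Z, hsep, hX, hY, hZ⟩ := hall N
  have hp0 : (0 : ℝ) < p := prime_cast_pos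
  have hNR : (N : ℝ) ≤ p := by exact_mod_cast hNp
  have hKp : K ≤ p := le_trans (le_trans (le_max_right _ _) hN.le) hNR
  have hpow : 2 / c ^ 2 ≤ (p : ℝ) ^ (2 * e - 3) := by
    have h1 : K ^ (2 * e - 3) ≤ (p : ℝ) ^ (2 * e - 3) :=
      Real.rpow_le_rpow (by positivity) hKp hδ.le
    have h2 : K ^ (2 * e - 3) = 2 / c ^ 2 := by
      rw [hK, ← Real.rpow_mul (by positivity)]
      have : 1 / (2 * e - 3) * (2 * e - 3) = 1 := by field_simp
      rw [this, Real.rpow_one]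
    rwa [h2] at h1
  have hYne : Y.Nonempty := by
    rw [← Finset.card_pos]
    have : (0 : ℝ) < Y.card := lt_of_lt_of_le (by positivity) hY
    exact_mod_cast this
  have hlow := sq_le_card_mul hc.le hX hZ
  have hup := wall_XZ_real hsep hYne
  have hsplit : (c * (p : ℝ) ^ e) * (c * (p : ℝ) ^ e)
      = c ^ 2 * (p : ℝ) ^ (2 * e - 3) * (p : ℝ) ^ 3 := by
    have : (p : ℝ) ^ e * (p : ℝ) ^ e = (p : ℝ) ^ (2 * e - 3) * (p : ℝ) ^ 3 := by
      rw [← Real.rpow_add hp0, ← Real.rpow_natCast, ← Real.rpow_add hp0]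
      congr 1; push_cast; ring
    calc (c * (p : ℝ) ^ e) * (c * (p : ℝ) ^ e) = c ^ 2 * ((p : ℝ) ^ e * (p : ℝ) ^ e) := by ring
      _ = c ^ 2 * (p : ℝ) ^ (2 * e - 3) * (p : ℝ) ^ 3 := by rw [this]; ring
  have hge : 2 * (p : ℝ) ^ 3 ≤ c ^ 2 * (p : ℝ) ^ (2 * e - 3) * (p : ℝ) ^ 3 := by
    have hc2 : 0 < c ^ 2 := by positivity
    have : 2 ≤ c ^ 2 * (p : ℝ) ^ (2 * e - 3) := by
      have := mul_le_mul_of_nonneg_left hpow hc2.le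
      rwa [mul_div_cancel₀ _ hc2.ne'] at this
    have hp3 : 0 ≤ (p : ℝ) ^ 3 := by positivity
    nlinarith
  have h2p : (2 : ℝ) < p := lt_of_lt_of_le (lt_of_le_of_lt (le_max_left _ _) hN) hNR
  have hlt : (p : ℝ) ^ 3 + (p : ℝ) ^ 2 < 2 * (p : ℝ) ^ 3 := by nlinarith
  linarith [hlow, hup, hge, hlt, hsplit.symm.le, hsplit.le]

end Summit.MatrixMultiplication.MatrixMultiplication.Theorems.LevelOneGL2Designs.Negative

end
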